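import Summits.BirchSwinnertonDyer.Rank1Residual.X10.BeyondCarrierResidualOfTwins
import Summits.BirchSwinnertonDyer.BirchSwinnertonDyer.Theorems.PrintX10bBeyondCarrierCoprimeFrames
import Summits.BirchSwinnertonDyer.BirchSwinnertonDyer.Theses.PrintX10b
import HarnessLib

/-!
# Crux `BeyondCarrierDepthX10b` (stmt-BirchSwinnertonDyer-23055, `route-BirchSwinnertonDyer-PrintX10b`
# rev 19, rank 301): the SHARP Howard twin A₃♯ — what the crux's load path actually asks of item
# 23729 — and the crux BY NAME from A₃♯ ∧ B₃ modulo the five named facts of the Howard road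

HONEST FRAMING (cell `run/shared/lean/pub/bsd-print-x9/`, D-0154 row 10 width seat `bsd-line-x10b-p1-w2`
on the registered line 8c72ce4e of crux 23055): THEOREMS ONLY, nothing booked, nothing closed.
«beyond-print theorem»: NO — conditional kernel glue; the open inputs are A₃♯ (below) and B₃
(= item 23730 `TwoSidedLinkAnyClassNumberX10b`), both BEYOND PRINT at `3 ∣ h_K`, plus the cite-only
facts `h46` / `hYZ` / `h331` / `hChaL` / `hKo`. BSD is not proved by any of this.

WHY. The registered skeleton v3 of crux 23055 (plan g5, 8c72ce4e) takes Howard's containment as the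
route item A₃ = `Theses.PrintX10b.HowardContainmentAnyClassNumberX10b` (stmt-23729) BY NAME: the
containment `I(ℋ_F)² ⊆ char_Λ(X_tors)` at EVERY X10b Heegner frame with `d_K ∉ {−3, −4}` (even `d_K`,
`3 ∤ h_K`, no rank / Ш / (irr_K) information). But the ONE use-site of A₃ on the crux's load path
(`…HowardFrames.indexIdentityAt_of_heegnerPoint_of_twins_of_thm331`, `Rank1Residual/X10/BeyondCarrierResidualOfTwins.lean`
l.184, p586853) applies it at the crux's own field `K` — `d_K ≡ 1 (mod 8)` (odd, `< −4`), in the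
`3 ∣ h_K` branch (the `3 ∤ h_K` frames are p581299) — AFTER Kolyvagin (`hKo`: `rank_ℤ E(K) = 1`, `Ш(E/K)`
finite), Matar–Nekovář ((irr_K) at `3`) and the Manin-good Heegner datum with `y_K` of infinite order are
in scope. This file records that in the kernel: the crux follows from the SHARP twin

  A₃♯ := A₃'s conclusion under the extra hypotheses `Odd d_K`, `3 ∣ h_K`, (irr_K) at `p`,
        a Manin-good datum `Dt` (`3 ∤ c(Dt)`), a point `P ∈ E(K)` over the Heegner point of `(Dt, H)`,
        `rank_ℤ E(K) = 1`, `Ш(E/K)[3^∞]` finite, `P` of infinite order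

(= B₃'s hypotheses with the containment turned into the conclusion, minus the embedding `ι : K → ℚ_3`)
together with B₃, modulo the same five facts. CONSEQUENCES (numbers, not adjectives): of the five regime
stubs of line `torsion-depth-x10b` on 23729 (cf94ebb4), TWO are off 23055's load path — `stub_coprimeClassNumber` (`3 ∤ h_K`; 23055 carries `h46`
itself) and `stub_depthPos_localized_evenDisc` (even `d_K`, the «typed-print gap» outside CGLS 2022's
(disc)) — and the promotion stub is needed only at Selmer corank ONE (`rank_ℤ E(K) = 1`, `Ш[3^∞]`
finite ⇒ `corank_{ℤ_3} Sel_{3^∞}(E/K) = 1` by the tree's `selmerCorank_eq_mordellWeilRank_add_holds`),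
where CGLS 2022 Thm. 4.1.3 «Moreover» (= Cor. 3.4.2) already removes the `(γ − 1)`-localisation: the
open content of A₃♯ is `stub_depthZero_divisibleClassNumber` + the odd-`d_K` module comparison + the
`μ`-part (powers of `3` only) of the promotion. `HowardContainmentAnyClassNumberX10b → A₃♯`
(`sharpHowardTwin_of_howardContainmentAnyClassNumberX10b`), so nothing of the registered line is lost.

WHAT.
* `indexIdentityAt_of_heegnerPoint_of_sharpTwins_of_thm331` — the Heegner-index identity over `K`
  (`X11b.IndexIdentityAt W 3 K P`) on these frames: p586853's `indexIdentityAt_of_heegnerPoint_of_twins_of_thm331`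
  VERBATIM with `hA` weakened to A₃♯ (fed the rank / finiteness / (irr_K) / datum facts derived there).
* `stub_beyondCarrier_divisibleClassNumber_of_sharpTwins_of_namedFacts (h331) (hChaL) (hKo) : A₃♯ → B₃ → s2`
  — the registered residual stub's conclusion `s2` (`3 ∣ h_K` frames of 23055, VERBATIM): p586853 §2
  VERBATIM with the previously unused frame binder `3 ∣ h_K` now consumed.
* `beyondCarrierDepthX10b_of_namedFacts_of_sharpTwins (h46 hYZ h331 hChaL hKo) (hA♯) (hB) :
  Theses.PrintX10b.BeyondCarrierDepthX10b` — the crux BY NAME (skeleton's case split with p581299).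
* `sharpHowardTwin_of_howardContainmentAnyClassNumberX10b` — item 23729 ⇒ A₃♯ (so p587786's door factors through §3).

References: [CastellaGrossiLeeSkinner2022] Thm. 4.1.3, Cor. 3.4.2, (disc); [Howard2004HeegnerKolyvagin] Thm. B;
[MastellaZerman2026] Cor. 4.6; [YanZhu2024MainConjNonCM] Thm. 5.7 (1), 5.9; [JetchevSkinnerWan2017] Thm. 3.3.1;
[Cha2005] Rmk. 25; [Kolyvagin1990] Thm. A; [MatarNekovar2019] Prop. 5.26 (2); skeleton 8c72ce4e
(`pub/bsd-print-x9/plan/skeletons/BeyondCarrierDepthX10b_birth_v3.lean`); route file `Theses/PrintX10b.lean` rev 19.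
-/

-- the REGISTERED stub namespace `Summit.BirchSwinnertonDyer.BirchSwinnertonDyer.Cruxes.…` repeats the summit name
set_option linter.dupNamespace false
set_option autoImplicit false

noncomputable section

open scoped Classical MatrixGroups ModularForm

open CongruenceSubgroup WeierstrassCurve NumberField IsDedekindDomain
  Literature.NumberTheory.EllipticCurves Literature.NumberTheory.EllipticCurves.ModularForms
  Literature.NumberTheory.EllipticCurves.JetchevSkinnerWan2017
  Literature.NumberTheory.EllipticCurves.YanZhu2026
  Summit.BirchSwinnertonDyer.BirchSwinnertonDyer.Theorems.Rank1ResidualX1Defs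
  Summit.BirchSwinnertonDyer.Rank1Residual
  Summit.BirchSwinnertonDyer.Rank1Residual.X11b.Three.Koly
  Summit.BirchSwinnertonDyer.Rank1Residual.X11b.KolyvaginBottom
  Summit.BirchSwinnertonDyer.BirchSwinnertonDyer.Rank1Residual
  Summit.BirchSwinnertonDyer.BirchSwinnertonDyer.Theses.PrintX10b

open Literature.NumberTheory.EllipticCurves.Rank1Residual (ClassX10 Surj)

namespace Summit.BirchSwinnertonDyer.BirchSwinnertonDyer.Cruxes.BeyondCarrierDepthX10b.HowardFrames

/-- **The Heegner-index identity over `K` at a Manin-unit Heegner datum of a NON-CM X10b pair (`p = 3`,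
`E[3]` irreducible, `ρ̄_{E,3}` not onto) over a Heegner field with `3` split, `d_K` odd `< −4` and
`3 ∣ h_K`, whose Heegner point `P` has INFINITE ORDER**, granted the SHARP `p = 3` Howard twin A₃♯ (the
containment only under `Odd d_K`, `3 ∣ h_K`, (irr_K), Manin-good datum, `rank_ℤ E(K) = 1`, `Ш[3^∞]`
finite, `P` Heegner of infinite order) and the two-sided link B₃ (item 23730). p586853's
`indexIdentityAt_of_heegnerPoint_of_twins_of_thm331` VERBATIM except that `hA` is the sharp twin, fed
with the facts that proof derives before its use-site: rank one and finiteness over `K` by Kolyvagin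
(`hKo`), (irr_K) by Matar–Nekovář Prop. 5.26 (2) (tree theorem), the anticyclotomic datum, and the
binder `3 ∣ h_K`. [cite: JetchevSkinnerWan2017, Thm. 3.3.1, §7.3.1 (eq:tamK)] [cite: Kolyvagin1990, Thm. A]
[cite: MatarNekovar2019, Prop. 5.26 (2)] [cite: Howard2004HeegnerKolyvagin, Thm. B (the containment, there under p ∤ h_K)]
[cite: CastellaGrossiLeeSkinner2022, Thm. 4.1.3 with Cor. 3.4.2 (corank one)] -/
theorem indexIdentityAt_of_heegnerPoint_of_sharpTwins_of_thm331
    (hA : ∀ (W : WeierstrassCurve ℚ) [W.IsElliptic] [W.IsGloballyMinimal] (p : ℕ) [Fact p.Prime]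
    [NeZero (W.conductorNorm ℤ)] (K : Type) [Field K] [NumberField K],
    Literature.NumberTheory.EllipticCurves.Rank1Residual.ClassX10 W p →
    ¬ Literature.NumberTheory.EllipticCurves.Rank1Residual.Surj W 3 → ¬ W.HasCM →
    Literature.NumberTheory.EllipticCurves.IsImaginaryQuadratic K → Odd (NumberField.discr K) →
    NumberField.discr K ≠ -3 →
    Literature.NumberTheory.EllipticCurves.SatisfiesHeegnerHypothesis (W.conductorNorm ℤ) K →
    Literature.NumberTheory.EllipticCurves.SatisfiesHeegnerHypothesis p K →
    (W.baseChange K).HasIrreducibleModPGaloisRep p → p ∣ NumberField.classNumber K →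
    ∀ (κ : Literature.NumberTheory.EllipticCurves.ZpExtension K p), κ.IsAnticyclotomic →
    ∀ (γ : Field.absoluteGaloisGroup K), κ.IsTopGenerator γ →
    ∀ (Dt : Literature.NumberTheory.EllipticCurves.ModularForms.ModularParametrizationData W
        (W.conductorNorm ℤ)), ¬ (p : ℤ) ∣ Dt.c →
    ∀ (H : Literature.NumberTheory.EllipticCurves.HeegnerDatum (W.conductorNorm ℤ) (NumberField.discr K))
      (ιC : K →+* ℂ) (P : (W.baseChange K).toAffine.Point),
      WeierstrassCurve.Affine.Point.map ιC.toRatAlgHom P =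
        Literature.NumberTheory.EllipticCurves.ModularForms.heegnerPointComplex Dt H →
      (W.baseChange K).mordellWeilRank = 1 →
      Finite (AddCommGroup.primaryComponent (W.baseChange K).sha p) → ¬ IsOfFinAddOrder P →
    ∃ (jbar : AlgebraicClosure K →+* ℂ) (D : (W.baseChange K).LambdaAdicSelmerData κ γ)
      (F : Literature.NumberTheory.EllipticCurves.HeegnerFamily (W.conductorNorm ℤ) W K κ jbar)
      (X : (W.baseChange K).SelmerDualData κ γ),
      Literature.NumberTheory.EllipticCurves.heegnerCharIdeal D F ^ 2 ≤
        Literature.NumberTheory.EllipticCurves.Module.charIdeal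
          (Literature.NumberTheory.EllipticCurves.IwasawaAlgebra p)
          (Submodule.torsion (Literature.NumberTheory.EllipticCurves.IwasawaAlgebra p) X.X))
    (hB : TwoSidedLinkAnyClassNumberX10b)
    (h331 : thm331_anticyclotomicControl)
    (W : WeierstrassCurve ℚ) [W.IsElliptic] [W.IsGloballyMinimal] [NeZero (W.conductorNorm ℤ)]
    (p : ℕ) [Fact p.Prime] (hX : ClassX10 W p) (hns : ¬ Surj W 3) (hcm : ¬ W.HasCM)
    (K : Type) [Field K] [NumberField K] (hKo : kolyvagin (W.conductorNorm ℤ) W K)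
    (hK : IsImaginaryQuadratic K) (hodd : Odd (NumberField.discr K)) (hlt : NumberField.discr K < -4)
    (hhK : p ∣ NumberField.classNumber K)
    (hHN : SatisfiesHeegnerHypothesis (W.conductorNorm ℤ) K) (hHp : SatisfiesHeegnerHypothesis p K)
    (Dt : ModularParametrizationData W (W.conductorNorm ℤ))
    (H : HeegnerDatum (W.conductorNorm ℤ) (NumberField.discr K)) (ιC : K →+* ℂ)
    (P : (W.baseChange K).toAffine.Point)
    (hP : WeierstrassCurve.Affine.Point.map ιC.toRatAlgHom P = heegnerPointComplex Dt H)
    (hPinf : ¬ IsOfFinAddOrder P) (hc : ¬ (p : ℤ) ∣ Dt.c) : X11b.IndexIdentityAt W p K P := by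
  obtain ⟨hp3, hord, hirr, -⟩ := id hX
  subst hp3
  have hpP : (3 : ℕ).Prime := Fact.out
  have hp2 : (3 : ℕ) ≠ 2 := by norm_num
  have h3 : NumberField.discr K ≠ -3 := by omega
  -- rank one and finiteness over `K` (Kolyvagin, from the non-torsion Heegner point)
  obtain ⟨hrk, hshaK⟩ := hKo hK hHN ⟨Dt, H, ιC, hP⟩ hPinf
  haveI : Finite (W.baseChange K).sha := hshaK
  have hfinp : Finite (AddCommGroup.primaryComponent (W.baseChange K).sha 3) :=
    Finite.of_injective _ Subtype.val_injective
  -- (irr_K) at this field (Matar–Nekovář Prop. 5.26 (2), a tree theorem)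
  have hirrK : (W.baseChange K).HasIrreducibleModPGaloisRep 3 :=
    MatarNekovar2019.prop526_hasIrreducibleModPGaloisRep_baseChange_holds W K hK.1
      (Literature.SatisfiesHeegnerHypothesis.coprime_discr hK.1 hHN) 3 hp2 hirr
  -- the anticyclotomic datum and the embedding at a prime above `3`
  obtain ⟨κ, γ, 𝔭, hκ, hγ, h𝔭⟩ := X11b.exists_anticyclotomic_generator_prime (p := 3) hK
  haveI : Fact (κ.IsTopGenerator γ) := ⟨hγ⟩
  have hsplit : X11b.SplitsIn K 3 := hHp 3 Fact.out (dvd_refl 3)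
  obtain ⟨he, hf⟩ := X11b.degreeOne_of_splitsIn hK.1 hsplit h𝔭
  set ι : K →+* ℚ_[3] := X11b.embAt K 3 𝔭 h𝔭 he hf with hι
  have hCTL : X11b.ControlOnTreeGoodAt 3 κ (X11b.inducedPlace ι) γ ι P :=
    X11b.controlOnTreeGoodAt_of_thm331_of_inducedPlace h331 le_rfl hord.1 hK hHp rfl hHN hirrK ι
      κ hκ γ hrk hfinp P hPinf
  -- Howard's containment at THIS frame, from the SHARP twin A₃♯ (all its extra hypotheses in scope)
  have hHow := hA W 3 K hX hns hcm hK hodd h3 hHN hHp hirrK hhK κ hκ γ hγ Dt hc H ιC P hP hrk hfinp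
    hPinf
  -- the two-sided link granted the containment, ANY class number (twin B₃)
  have hIW : X11b.IMCWaldspurgerOnTreeGoodAt 3 κ (X11b.inducedPlace ι) γ ι P :=
    hB W 3 K hX hns hcm hK hodd h3 hHN hHp hirrK ι κ hκ γ Dt hc H ιC P hP hrk hfinp hPinf hHow
  exact X11b.indexIdentityAt_of_onTreeGoodLinks_of_allSplit hK rfl hHN hIW hCTL

/-- **The `3 ∣ h_K` frames of crux `BeyondCarrierDepthX10b` (item 23055) — the conclusion `s2` of the
registered stub `stub_beyondCarrier_divisibleClassNumber_of_twins`, VERBATIM — from the SHARP twin A₃♯ and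
B₃, modulo THREE named facts** (`h331` JSW Thm. 3.3.1, `hChaL` Cha Rmk. 25 lower half, `hKo` Kolyvagin
Thm. A; Shimura reciprocity at conductor `1` is the tree theorem `heegnerPointOfConductor_one_galoisConj_holds`):
on every rev-3b X10b Heegner frame (`p = 3`, `E[3]` irreducible, `ρ̄_{E,3}` not onto, non-CM, `r_an = 1`;
`d_K ≡ 1 (mod 8)`, `N_E` and `3` split, Manin-good, `y_K` of infinite order) WITH `3 ∣ h_K`, for every
beyond-carrier depth `s ≤ ord_3 ∏ c_q(E)`, every derived Heegner point `P_n` on Kolyvagin primes of index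
`≥ s` is `3^s`-divisible in `E(K[n])` (bound `B = 4`). p586853 §2 VERBATIM, except that the frame binder
`3 ∣ h_K` — unused there — is now THREADED to the sharp twin through §1.
[cite: Cha2005, Thm. 21 and Rmk. 25] [cite: JetchevSkinnerWan2017, Thm. 3.3.1] [cite: Kolyvagin1990, Thm. A]
[cite: McCallumLMS1991, §5 (Lemma 5.1)] [cite: Darmon2004, Thm. 3.7] [cite: MatarNekovar2019, Thm. 0.7, §0.9, §0.11] -/
theorem stub_beyondCarrier_divisibleClassNumber_of_sharpTwins_of_namedFacts
    (h331 : thm331_anticyclotomicControl)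
    (hChaL : Cha2005.rmk25_pow_dvd_card_sha_primary_of_certificate)
    (hKo : ∀ (N : ℕ) [NeZero N] (W : WeierstrassCurve ℚ) (K : Type) [Field K] [NumberField K],
      kolyvagin N W K) :
    (∀ (W : WeierstrassCurve ℚ) [W.IsElliptic] [W.IsGloballyMinimal] (p : ℕ) [Fact p.Prime]
    [NeZero (W.conductorNorm ℤ)] (K : Type) [Field K] [NumberField K],
    Literature.NumberTheory.EllipticCurves.Rank1Residual.ClassX10 W p →
    ¬ Literature.NumberTheory.EllipticCurves.Rank1Residual.Surj W 3 → ¬ W.HasCM →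
    Literature.NumberTheory.EllipticCurves.IsImaginaryQuadratic K → Odd (NumberField.discr K) →
    NumberField.discr K ≠ -3 →
    Literature.NumberTheory.EllipticCurves.SatisfiesHeegnerHypothesis (W.conductorNorm ℤ) K →
    Literature.NumberTheory.EllipticCurves.SatisfiesHeegnerHypothesis p K →
    (W.baseChange K).HasIrreducibleModPGaloisRep p → p ∣ NumberField.classNumber K →
    ∀ (κ : Literature.NumberTheory.EllipticCurves.ZpExtension K p), κ.IsAnticyclotomic →
    ∀ (γ : Field.absoluteGaloisGroup K), κ.IsTopGenerator γ →
    ∀ (Dt : Literature.NumberTheory.EllipticCurves.ModularForms.ModularParametrizationData W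
        (W.conductorNorm ℤ)), ¬ (p : ℤ) ∣ Dt.c →
    ∀ (H : Literature.NumberTheory.EllipticCurves.HeegnerDatum (W.conductorNorm ℤ) (NumberField.discr K))
      (ιC : K →+* ℂ) (P : (W.baseChange K).toAffine.Point),
      WeierstrassCurve.Affine.Point.map ιC.toRatAlgHom P =
        Literature.NumberTheory.EllipticCurves.ModularForms.heegnerPointComplex Dt H →
      (W.baseChange K).mordellWeilRank = 1 →
      Finite (AddCommGroup.primaryComponent (W.baseChange K).sha p) → ¬ IsOfFinAddOrder P →
    ∃ (jbar : AlgebraicClosure K →+* ℂ) (D : (W.baseChange K).LambdaAdicSelmerData κ γ)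
      (F : Literature.NumberTheory.EllipticCurves.HeegnerFamily (W.conductorNorm ℤ) W K κ jbar)
      (X : (W.baseChange K).SelmerDualData κ γ),
      Literature.NumberTheory.EllipticCurves.heegnerCharIdeal D F ^ 2 ≤
        Literature.NumberTheory.EllipticCurves.Module.charIdeal
          (Literature.NumberTheory.EllipticCurves.IwasawaAlgebra p)
          (Submodule.torsion (Literature.NumberTheory.EllipticCurves.IwasawaAlgebra p) X.X)) →
    TwoSidedLinkAnyClassNumberX10b →
    ∀ (W : WeierstrassCurve ℚ) [W.IsElliptic] [W.IsGloballyMinimal] [NeZero (W.conductorNorm ℤ)] (p : ℕ) [Fact p.Prime], Literature.NumberTheory.EllipticCurves.Rank1Residual.ClassX10 W p → ¬ Literature.NumberTheory.EllipticCurves.Rank1Residual.Surj W 3 → ¬ W.HasCM → W.analyticRank = 1 → ∃ B : ℕ, ∀ (K : Type) [Field K] [NumberField K] (Dt : Literature.NumberTheory.EllipticCurves.ModularForms.ModularParametrizationData W (W.conductorNorm ℤ)) (β : ℤ) (ι : K →+* ℂ), Literature.NumberTheory.EllipticCurves.IsImaginaryQuadratic K → B < (NumberField.discr K).natAbs → NumberField.discr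 K % 8 = 1 → Literature.NumberTheory.EllipticCurves.SatisfiesHeegnerHypothesis (W.conductorNorm ℤ) K → Literature.NumberTheory.EllipticCurves.SatisfiesHeegnerHypothesis p K → p ∣ NumberField.classNumber K → (4 * (W.conductorNorm ℤ : ℤ)) ∣ β ^ 2 - NumberField.discr K → ¬ (p : ℤ) ∣ Dt.c → ∀ (d₁ : Literature.NumberTheory.EllipticCurves.KolyvaginHeegnerData Dt β ι 1), ¬ IsOfFinAddOrder d₁.derivedPoint → ∀ (s : ℕ), (∀ (q : ℕ) [Fact q.Prime], q ∣ W.conductorNorm ℤ → padicValNat p ((W.baseChange ℚ_[q]).localTamagawaNumber ℤ_[q]) < s) → s ≤ padicValNat p W.tamagawaProduct → ∀ (n : ℕ) (d : Literature.NumberTheory.EllipticCurves.KolyvaginHeegnerData Dt β ι n), Squarefree n → (∀ ℓ ∈ n.primeFactors, Literature.NumberTheory.EllipticCurves.Zhang2014.IsKolyvaginPrime (W.conductorNorm ℤ) W K p ℓ ∧ s ≤ Literature.NumberTheory.EllipticCurves.Zhang2014.kolyvaginIndex W p ℓ) → ∃ Q : (W.baseChange (Literature.NumberTheory.EllipticCurves.ringClassField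 K ι n)).toAffine.Point, ((p ^ s : ℕ) : ℤ) • Q = d.derivedPoint := by
  intro hA hB W _ _ _ p _ hX hns hcm _
  obtain ⟨hp3, hordW, hirr, -⟩ := id hX
  subst hp3
  refine ⟨4, ?_⟩
  intro K _ _ Dt β ι hK hBK hd8 hHN hHp hhK hβ hc d₁ hd₁ s _ hs n d hn hℓ
  -- Shimura reciprocity at conductor `1`: a tree THEOREM (Darmon Thm. 3.7)
  have hrec : ∀ (N : ℕ) [NeZero N] (W : WeierstrassCurve ℚ) (K : Type) [Field K] [NumberField K],
      heegnerPointOfConductor_one_galoisConj N W K :=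
    fun N _ W K _ _ ↦ heegnerPointOfConductor_one_galoisConj_holds N W K
  have hodd : Odd (NumberField.discr K) := Int.odd_iff.mpr (by omega)
  have hpP : (3 : ℕ).Prime := Fact.out
  have hp2 : (3 : ℕ) ≠ 2 := by norm_num
  have hneg : NumberField.discr K < 0 := IsImaginaryQuadratic.discr_neg hK
  have hlt : NumberField.discr K < -4 := by omega
  have h3 : NumberField.discr K ≠ -3 := by omega
  have h4 : NumberField.discr K ≠ -4 := by omega
  have hpd : ¬ ((3 : ℕ) : ℤ) ∣ NumberField.discr K :=
    Literature.SatisfiesHeegnerHypothesis.not_dvd_discr hK.1 hHp hpP (dvd_refl 3)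
  have hpN : ¬ 3 ∣ W.conductorNorm ℤ := fun h ↦
    (W.dvd_conductorNorm_iff_not_hasGoodReductionAtPrime 3).mp h hordW.1
  have hpN2 : ¬ 3 ^ 2 ∣ W.conductorNorm ℤ := fun h ↦ hpN (dvd_trans (dvd_pow_self 3 two_ne_zero) h)
  -- depth `0` is trivial
  rcases Nat.eq_zero_or_pos s with rfl | hs1
  · exact ⟨d.derivedPoint, by rw [pow_zero, Nat.cast_one, one_zsmul]⟩
  -- the oriented Heegner datum of the frame and THE Heegner point `y_K ∈ E(K)`
  obtain ⟨H, hHβ⟩ := exists_heegnerDatum (W.conductorNorm ℤ) hneg hβ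
  obtain ⟨P, hP⟩ := heegnerPointComplex_mem_range_map_holds (W.conductorNorm ℤ) W K hK hHN Dt H ι
  have hPd : d₁.toGeomPoints d₁.derivedPoint = toGeomPoints (W.baseChange K) P :=
    toGeomPoints_derivedPoint_one_eq (hrec _ W K) hK hHN hP d₁ hHβ
  have hPinf : ¬ IsOfFinAddOrder P := fun hfin ↦
    hd₁ ((isOfFinAddOrder_derivedPoint_one_iff (hrec _ W K) hK hHN hP d₁ hHβ).mpr hfin)
  -- the identity over `K` at this frame, `3 ∣ h_K` (§1, from the sharp twin and B₃)
  have hid := indexIdentityAt_of_heegnerPoint_of_sharpTwins_of_thm331 hA hB h331 W 3 hX hns hcm K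
    (hKo _ W K) hK hodd hlt hhK hHN hHp Dt H ι P hP hPinf hc
  -- rank one and finiteness over `K` (Kolyvagin), no `p`-torsion (irreducibility)
  obtain ⟨hrank, hshaK⟩ := hKo (W.conductorNorm ℤ) W K hK hHN ⟨Dt, H, ι, hP⟩ hPinf
  haveI : Finite (W.baseChange K).sha := hshaK
  haveI hfinp : Finite (AddCommGroup.primaryComponent (W.baseChange K).sha 3) :=
    Finite.of_injective _ Subtype.val_injective
  have hbot := torsionBy_eq_bot_of_isImaginaryQuadratic_of_hasIrreducibleModPGaloisRep W K hK hpP hirr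
  have hiv : ∀ x : (W.baseChange K).toAffine.Point, 3 • x = 0 → x = 0 := fun x hx ↦ by
    have hmem : x ∈ AddSubgroup.torsionBy (W.baseChange K).toAffine.Point (((3 : ℕ) : ℕ) : ℤ) := by
      rw [mem_torsionBy_iff, natCast_zsmul]
      exact hx
    rw [hbot] at hmem
    exact hmem
  -- the exponent `p^{M₀} ∥ y_K` in `E(K)` and `ord_p [E(K):ℤy_K] = M₀` (McCallum Lemma 5.1)
  haveI : Module.Finite ℤ (W.baseChange K).toAffine.Point := (W.baseChange K).module_finite_point_holds
  obtain ⟨M₀, x₀, hx₀, hmax⟩ := exists_pow_smul_eq_and_forall_ne hPinf (p := 3) hpP.two_le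
  have hdiv : ∃ Q : (W.baseChange K).toAffine.Point, ((3 ^ M₀ : ℕ) : ℤ) • Q = P :=
    ⟨x₀, by rw [natCast_zsmul]; exact hx₀⟩
  have hndiv : ¬ ∃ Q : (W.baseChange K).toAffine.Point, ((3 ^ (M₀ + 1) : ℕ) : ℤ) • Q = P := by
    rintro ⟨Q, hQ⟩
    exact hmax Q (by rw [← natCast_zsmul]; exact hQ)
  haveI : Finite (AddCommGroup.torsion (W.baseChange K).toAffine.Point) :=
    WeierstrassCurve.finite_torsion_point (W := W.baseChange K)
  obtain ⟨c, Q, hcQ, hcker⟩ := X11b.RankOne.exists_coord_of_mordellWeilRank_eq_one (W.baseChange K) hrank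
  have hidx : padicValNat 3 (AddSubgroup.zmultiples P).index = M₀ :=
    padicValNat_index_zmultiples_eq_of_divisibility c Q hcQ hcker hiv P hdiv hndiv
  -- suppose `P_n ∉ 3^s E(K_n)`: a level-`s` certificate; Cha's LOWER half bounds `#Ш` from below
  by_contra hQ
  have hcert := hChaL W hcm K hK h3 h4 hHN 3 hp2 hpd hpN2 hirr Dt β ι d₁ P hPd hPinf M₀
    hdiv hndiv n (s - 1) d hn
    (fun ℓ hℓ' ↦ ⟨(hℓ ℓ hℓ').1, by have := (hℓ ℓ hℓ').2; omega⟩)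
    (by rw [Nat.sub_add_cancel hs1]; exact hQ)
  have hle : 2 * (M₀ - (s - 1)) ≤
      padicValNat 3 (Nat.card (AddCommGroup.primaryComponent (W.baseChange K).sha 3)) :=
    (padicValNat_dvd_iff_le Nat.card_pos.ne').mp hcert
  rw [padicValNat_card_addPrimaryComponent (A := (W.baseChange K).sha) 3] at hle
  -- the identity: `2t + ord_p #Ш(E/K) = 2M₀`
  unfold X11b.IndexIdentityAt at hid
  rw [WeierstrassCurve.shaOrder, hidx] at hid
  omega

/-- **Crux `BeyondCarrierDepthX10b` (item 23055) BY NAME from the SHARP Howard twin A₃♯, the two-sided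
link B₃ (item 23730) and the five named facts of the Howard road** (`h46` Mastella–Zerman 2026 Cor. 4.6,
`hYZ` the Yan–Zhu/BCS/CGLS composite, `h331` JSW 2017 Thm. 3.3.1, `hChaL` Cha 2005 Rmk. 25 lower half,
`hKo` Kolyvagin 1990 Thm. A): the Howard frames `3 ∤ h_K` by p581299, the residual frames `3 ∣ h_K` by
§2, composed by the registered skeleton's case split on `3 ∣ h_K` (bound `max B₁ B₂`). Compared with the
door of record `beyondCarrierDepthX10b_of_namedFacts_of_twins` (p587786: item 23729 ∧ item 23730), the
Howard input is asked ONLY on the frames the crux quantifies over (`d_K` odd, `3 ∣ h_K`, rank one,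
`Ш[3^∞]` finite, Manin-good datum, Heegner point of infinite order).
[cite: MastellaZerman2026, Cor. 4.6] [cite: YanZhu2024MainConjNonCM, Thm. 5.7 (1), Thm. 5.9]
[cite: JetchevSkinnerWan2017, Thm. 3.3.1] [cite: Cha2005, Thm. 21 and Rmk. 25] [cite: Kolyvagin1990, Thm. A]
[cite: CastellaGrossiLeeSkinner2022, Thm. 4.1.3 (the corank-one «Moreover» this sharpening makes available)] -/
theorem beyondCarrierDepthX10b_of_namedFacts_of_sharpTwins
    (h46 : MastellaZerman2026.cor46_howardDivisibility_of_scalarImage.{0})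
    (hYZ : thm57_thm59_bcs422_cgls513_generator_constantCoeff_of_heegnerDivisibility)
    (h331 : thm331_anticyclotomicControl)
    (hChaL : Cha2005.rmk25_pow_dvd_card_sha_primary_of_certificate)
    (hKo : ∀ (N : ℕ) [NeZero N] (W : WeierstrassCurve ℚ) (K : Type) [Field K] [NumberField K],
      kolyvagin N W K)
    (hA : ∀ (W : WeierstrassCurve ℚ) [W.IsElliptic] [W.IsGloballyMinimal] (p : ℕ) [Fact p.Prime]
    [NeZero (W.conductorNorm ℤ)] (K : Type) [Field K] [NumberField K],
    Literature.NumberTheory.EllipticCurves.Rank1Residual.ClassX10 W p →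
    ¬ Literature.NumberTheory.EllipticCurves.Rank1Residual.Surj W 3 → ¬ W.HasCM →
    Literature.NumberTheory.EllipticCurves.IsImaginaryQuadratic K → Odd (NumberField.discr K) →
    NumberField.discr K ≠ -3 →
    Literature.NumberTheory.EllipticCurves.SatisfiesHeegnerHypothesis (W.conductorNorm ℤ) K →
    Literature.NumberTheory.EllipticCurves.SatisfiesHeegnerHypothesis p K →
    (W.baseChange K).HasIrreducibleModPGaloisRep p → p ∣ NumberField.classNumber K →
    ∀ (κ : Literature.NumberTheory.EllipticCurves.ZpExtension K p), κ.IsAnticyclotomic →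
    ∀ (γ : Field.absoluteGaloisGroup K), κ.IsTopGenerator γ →
    ∀ (Dt : Literature.NumberTheory.EllipticCurves.ModularForms.ModularParametrizationData W
        (W.conductorNorm ℤ)), ¬ (p : ℤ) ∣ Dt.c →
    ∀ (H : Literature.NumberTheory.EllipticCurves.HeegnerDatum (W.conductorNorm ℤ) (NumberField.discr K))
      (ιC : K →+* ℂ) (P : (W.baseChange K).toAffine.Point),
      WeierstrassCurve.Affine.Point.map ιC.toRatAlgHom P =
        Literature.NumberTheory.EllipticCurves.ModularForms.heegnerPointComplex Dt H →
      (W.baseChange K).mordellWeilRank = 1 →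
      Finite (AddCommGroup.primaryComponent (W.baseChange K).sha p) → ¬ IsOfFinAddOrder P →
    ∃ (jbar : AlgebraicClosure K →+* ℂ) (D : (W.baseChange K).LambdaAdicSelmerData κ γ)
      (F : Literature.NumberTheory.EllipticCurves.HeegnerFamily (W.conductorNorm ℤ) W K κ jbar)
      (X : (W.baseChange K).SelmerDualData κ γ),
      Literature.NumberTheory.EllipticCurves.heegnerCharIdeal D F ^ 2 ≤
        Literature.NumberTheory.EllipticCurves.Module.charIdeal
          (Literature.NumberTheory.EllipticCurves.IwasawaAlgebra p)
          (Submodule.torsion (Literature.NumberTheory.EllipticCurves.IwasawaAlgebra p) X.X))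
    (hB : TwoSidedLinkAnyClassNumberX10b) :
    BeyondCarrierDepthX10b := by
  intro W _ _ _ p _ hX hns hcm hr
  obtain ⟨B₁, h₁⟩ := stub_beyondCarrier_coprimeClassNumber_of_namedFacts h46 hYZ h331 hChaL hKo W p hX
    hns hcm hr
  obtain ⟨B₂, h₂⟩ := stub_beyondCarrier_divisibleClassNumber_of_sharpTwins_of_namedFacts h331 hChaL hKo
    hA hB W p hX hns hcm hr
  refine ⟨max B₁ B₂, fun K _ _ Dt β ι hK hBK hd8 hHN hHp hβ hc d₁ hd₁ s hcar hs n d hn hℓ ↦ ?_⟩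
  by_cases hh : p ∣ NumberField.classNumber K
  · exact h₂ K Dt β ι hK (lt_of_le_of_lt (le_max_right B₁ B₂) hBK) hd8 hHN hHp hh hβ hc d₁ hd₁ s hcar
      hs n d hn hℓ
  · exact h₁ K Dt β ι hK (lt_of_le_of_lt (le_max_left B₁ B₂) hBK) hd8 hHN hHp hh hβ hc d₁ hd₁ s hcar
      hs n d hn hℓ

/-- **Item 23729 ⇒ the sharp twin A₃♯**: Howard's containment at every X10b Heegner frame with
`d_K ∉ {−3, −4}` (`Theses.PrintX10b.HowardContainmentAnyClassNumberX10b`) gives it in particular on the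
odd-`d_K`, `3 ∣ h_K`, rank-one, finite-Ш, Manin-good frames; the extra hypotheses are discarded
(`d_K ≠ −4` because `d_K` is odd). [cite: Howard2004HeegnerKolyvagin, Thm. B] -/
theorem sharpHowardTwin_of_howardContainmentAnyClassNumberX10b (hA : HowardContainmentAnyClassNumberX10b) :
    ∀ (W : WeierstrassCurve ℚ) [W.IsElliptic] [W.IsGloballyMinimal] (p : ℕ) [Fact p.Prime]
    [NeZero (W.conductorNorm ℤ)] (K : Type) [Field K] [NumberField K],
    Literature.NumberTheory.EllipticCurves.Rank1Residual.ClassX10 W p →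
    ¬ Literature.NumberTheory.EllipticCurves.Rank1Residual.Surj W 3 → ¬ W.HasCM →
    Literature.NumberTheory.EllipticCurves.IsImaginaryQuadratic K → Odd (NumberField.discr K) →
    NumberField.discr K ≠ -3 →
    Literature.NumberTheory.EllipticCurves.SatisfiesHeegnerHypothesis (W.conductorNorm ℤ) K →
    Literature.NumberTheory.EllipticCurves.SatisfiesHeegnerHypothesis p K →
    (W.baseChange K).HasIrreducibleModPGaloisRep p → p ∣ NumberField.classNumber K →
    ∀ (κ : Literature.NumberTheory.EllipticCurves.ZpExtension K p), κ.IsAnticyclotomic →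
    ∀ (γ : Field.absoluteGaloisGroup K), κ.IsTopGenerator γ →
    ∀ (Dt : Literature.NumberTheory.EllipticCurves.ModularForms.ModularParametrizationData W
        (W.conductorNorm ℤ)), ¬ (p : ℤ) ∣ Dt.c →
    ∀ (H : Literature.NumberTheory.EllipticCurves.HeegnerDatum (W.conductorNorm ℤ) (NumberField.discr K))
      (ιC : K →+* ℂ) (P : (W.baseChange K).toAffine.Point),
      WeierstrassCurve.Affine.Point.map ιC.toRatAlgHom P =
        Literature.NumberTheory.EllipticCurves.ModularForms.heegnerPointComplex Dt H →
      (W.baseChange K).mordellWeilRank = 1 →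
      Finite (AddCommGroup.primaryComponent (W.baseChange K).sha p) → ¬ IsOfFinAddOrder P →
    ∃ (jbar : AlgebraicClosure K →+* ℂ) (D : (W.baseChange K).LambdaAdicSelmerData κ γ)
      (F : Literature.NumberTheory.EllipticCurves.HeegnerFamily (W.conductorNorm ℤ) W K κ jbar)
      (X : (W.baseChange K).SelmerDualData κ γ),
      Literature.NumberTheory.EllipticCurves.heegnerCharIdeal D F ^ 2 ≤
        Literature.NumberTheory.EllipticCurves.Module.charIdeal
          (Literature.NumberTheory.EllipticCurves.IwasawaAlgebra p)
          (Submodule.torsion (Literature.NumberTheory.EllipticCurves.IwasawaAlgebra p) X.X) := by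
  intro W _ _ p _ _ K _ _ hX hns hcm hK hodd h3 hHN hHp _ _ κ hκ γ hγ Dt _ H ιC _ _ _ _ _
  have h4 : NumberField.discr K ≠ -4 := by
    rintro h
    rw [h] at hodd
    exact absurd hodd (by decide)
  exact hA W p K hX hns hcm hK h3 h4 hHN hHp κ hκ γ hγ Dt H ιC

end Summit.BirchSwinnertonDyer.BirchSwinnertonDyer.Cruxes.BeyondCarrierDepthX10b.HowardFrames

end
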